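import Summits.RiemannHypothesis.RiemannHypothesis.Theorems.GroundBartaEvenWinsBeyondArchLatticeRippleSum
import Literature.NumberTheory.LFunctions.WeilTwoPrimeMinorant
import Literature.Barriers.RiemannHypothesis.TuranMinWitnessSound
import HarnessLib

/-!
# RiemannHypothesis / GroundBarta machinery — PHANTOM CERTIFICATES: the tail LEVEL of `w₂₃ + P` for separable phantoms

Helper file (`--supports stmt-RiemannHypothesis-18085`; infrastructure for the Weil-positivity ladder), RH-free, axioms
standard.  Seat rh-explicit-weil-1.  Discharges the hypothesis `hlevel : ∀ |t| ≥ T, wL ≤ w₂₃(t) + P(t)` of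
`WeilCert23X.weilTwoPrimeQuadratic_nonneg_of_check` (file `…PhantomCertificateSound.lean`) for SEPARABLE phantoms
`P(t) = Σ_j α_j cos(j t log 2) + Σ_k β_k cos(k t log 3)` (`rsOfSep`), by a kernel-checkable certificate:

`w₂₃(t) + P(t) = Re ψ(1/4 + it/2) + f₂(t log 2) + f₃(t log 3)`,  `f₂(θ) = −√2 log 2 · cos θ + Σ α_j cos(jθ)`,
`f₃(θ) = −(2 log 3/√3) cos θ + Σ β_k cos(kθ)`; `Re ψ(1/4+it/2) ≥ Re ψ(1/4+iT/2) ≥ wLoZ` (engine, `wLoZ_le`, monotone) for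
`|t| ≥ T`; and each `f_i ≥ m_i` on the whole circle by a rational SUM-OF-SQUARES witness `h_i` (Fejér–Riesz):
`f(θ) − |h(e^{iθ})|²` is a cosine polynomial whose collected coefficients `ρ_l` give `f ≥ −Σ|ρ_l|`
(`cosList_ge_sosBound`).  No calculus, exact rational arithmetic.

* `cosList`, `collect`, `cosList_eq_sum_collect`, `sqTerms`, `cosList_sqTerms_nonneg`, `sosBound`, `cosList_ge_sosBound`;
* `rsOfSep`, `ripplesVal_rsOfSep`; `SepLevelCert`, `SepLevelCert.check`, **`SepLevelCert.level_of_check`**.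
Everything here is proved; no named facts.
-/

set_option linter.dupNamespace false

noncomputable section

open Complex Filter Set MeasureTheory Finset
open scoped Real Topology BigOperators

namespace Summit.RiemannHypothesis.RiemannHypothesis.Theorems.EvenWinsBeyondArch

open Literature.NumberTheory.LFunctions
open Literature.Analysis.ValidatedNumerics.Numerics
open Literature.Analysis.SpecialFunctions

/-! ## Sparse cosine polynomials and collected coefficients -/

/-- `Σ_{(f, c) ∈ L} c · cos(f θ)` for a list of (integer frequency, rational coefficient) pairs. [folklore] -/
def cosList (L : List (ℤ × ℚ)) (θ : ℝ) : ℝ := (L.map fun p ↦ (p.2 : ℝ) * Real.cos ((p.1 : ℝ) * θ)).sum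

/-- The collected coefficient of the harmonic `l`: `Σ_{(f,c) ∈ L, |f| = l} c`. [folklore] -/
def collect (L : List (ℤ × ℚ)) (l : ℕ) : ℚ := (L.map fun p ↦ if p.1.natAbs = l then p.2 else 0).sum

/-- `cos(f θ) = cos(|f| θ)`. [folklore] -/
theorem cos_int_mul_eq_natAbs (f : ℤ) (θ : ℝ) : Real.cos ((f : ℝ) * θ) = Real.cos ((f.natAbs : ℝ) * θ) := by
  rcases Int.natAbs_eq f with h | h
  · conv_lhs => rw [h]
    simp
  · conv_lhs => rw [h]
    simp [neg_mul, Real.cos_neg]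

/-- **Collecting terms.** If every frequency satisfies `|f| ≤ Lmax`, `cosList L θ = Σ_{l ≤ Lmax} collect L l · cos(lθ)`. [folklore] -/
theorem cosList_eq_sum_collect {L : List (ℤ × ℚ)} {Lmax : ℕ} (hL : ∀ p ∈ L, p.1.natAbs ≤ Lmax) (θ : ℝ) :
    cosList L θ = ∑ l ∈ range (Lmax + 1), ((collect L l : ℚ) : ℝ) * Real.cos ((l : ℝ) * θ) := by
  induction L with
  | nil => simp [cosList, collect]
  | cons p ps ih =>
    have hp : p.1.natAbs ≤ Lmax := hL p (by simp)
    have ih' := ih fun q hq ↦ hL q (by simp [hq])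
    unfold cosList collect at *
    simp only [List.map_cons, List.sum_cons]
    rw [ih']
    have e : ∀ l, (((if p.1.natAbs = l then p.2 else 0) + (ps.map fun q ↦ if q.1.natAbs = l then q.2 else 0).sum : ℚ) : ℝ) *
        Real.cos ((l : ℝ) * θ) = ((if p.1.natAbs = l then p.2 else 0 : ℚ) : ℝ) * Real.cos ((l : ℝ) * θ) +
        (((ps.map fun q ↦ if q.1.natAbs = l then q.2 else 0).sum : ℚ) : ℝ) * Real.cos ((l : ℝ) * θ) := by
      intro l; push_cast; ring
    simp_rw [e]
    rw [Finset.sum_add_distrib]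
    congr 1
    rw [cos_int_mul_eq_natAbs]
    have : ∑ l ∈ range (Lmax + 1), ((if p.1.natAbs = l then p.2 else 0 : ℚ) : ℝ) * Real.cos ((l : ℝ) * θ) =
        ∑ l ∈ range (Lmax + 1), (if p.1.natAbs = l then (p.2 : ℝ) * Real.cos ((l : ℝ) * θ) else 0) := by
      refine Finset.sum_congr rfl fun l _ ↦ ?_
      split_ifs <;> simp
    rw [this, Finset.sum_ite_eq]
    rw [if_pos (Finset.mem_range.2 (by omega))]

/-- `Σ_{l ≤ Lmax} |collect L l|`. [folklore] -/
def sumAbsCollect (L : List (ℤ × ℚ)) (Lmax : ℕ) : ℚ := sumR (Lmax + 1) fun l ↦ |collect L l|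

/-- **Crude bound.** `cosList L θ ≥ −Σ_{l ≤ Lmax} |collect L l|`. [folklore] -/
theorem cosList_ge_neg_sumAbs {L : List (ℤ × ℚ)} {Lmax : ℕ} (hL : ∀ p ∈ L, p.1.natAbs ≤ Lmax) (θ : ℝ) :
    -((sumAbsCollect L Lmax : ℚ) : ℝ) ≤ cosList L θ := by
  rw [cosList_eq_sum_collect hL, sumAbsCollect, sumR_eq_sum]
  push_cast
  rw [← Finset.sum_neg_distrib]
  refine Finset.sum_le_sum fun l _ ↦ ?_
  have h1 : |((collect L l : ℚ) : ℝ) * Real.cos ((l : ℝ) * θ)| ≤ |((collect L l : ℚ) : ℝ)| := by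
    rw [abs_mul]; exact mul_le_of_le_one_right (abs_nonneg _) (Real.abs_cos_le_one _)
  have e : |((collect L l : ℚ) : ℝ)| = ((|collect L l| : ℚ) : ℝ) := by push_cast; rfl
  linarith [neg_abs_le (((collect L l : ℚ) : ℝ) * Real.cos ((l : ℝ) * θ))]

/-! ## Sums of squares: `|h(e^{iθ})|²` as a cosine list -/

/-- The terms `((n − m), h_n h_m)` of `|h(e^{iθ})|² = Σ_{n,m} h_n h_m cos((n−m)θ)`. [folklore] -/
def sqTerms (hs : List ℚ) : List (ℤ × ℚ) :=
  (List.range hs.length).flatMap fun (n : ℕ) ↦ (List.range hs.length).map fun (m : ℕ) ↦ (((n : ℤ) - (m : ℤ)), getV hs n * getV hs m)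

/-- `(l.flatMap f).sum = Σ_{a ∈ l} (f a).sum` (maps pushed inside). [folklore] -/
theorem sum_map_flatMap {α β : Type*} (l : List α) (f : α → List β) (g : β → ℝ) :
    ((l.flatMap f).map g).sum = (l.map fun a ↦ ((f a).map g).sum).sum := by
  induction l with
  | nil => simp
  | cons a as ih => simp only [List.flatMap_cons, List.map_append, List.sum_append, List.map_cons, List.sum_cons, ih]

/-- `cosList (sqTerms hs) θ = (Σ h_n cos nθ)² + (Σ h_n sin nθ)²`. [folklore] -/
theorem cosList_sqTerms (hs : List ℚ) (θ : ℝ) :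
    cosList (sqTerms hs) θ = (∑ n ∈ range hs.length, ((getV hs n : ℚ) : ℝ) * Real.cos ((n : ℝ) * θ)) ^ 2 +
      (∑ n ∈ range hs.length, ((getV hs n : ℚ) : ℝ) * Real.sin ((n : ℝ) * θ)) ^ 2 := by
  unfold cosList sqTerms
  rw [sum_map_flatMap, Literature.Barriers.RiemannHypothesis.TuranMinWitness.sum_map_range]
  have e : ∀ n : ℕ, (((List.range hs.length).map (fun (m : ℕ) ↦ (((n : ℤ) - (m : ℤ)), getV hs n * getV hs m))).map
      (fun p : ℤ × ℚ ↦ (p.2 : ℝ) * Real.cos ((p.1 : ℝ) * θ))).sum =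
      ∑ m ∈ range hs.length, ((getV hs n : ℚ) : ℝ) * (getV hs m : ℚ) * Real.cos (((n : ℝ) - m) * θ) := by
    intro n
    rw [List.map_map, Literature.Barriers.RiemannHypothesis.TuranMinWitness.sum_map_range]
    refine Finset.sum_congr rfl fun m _ ↦ ?_
    simp only [Function.comp]
    push_cast
    ring_nf
  simp_rw [e, sq, Finset.sum_mul_sum, ← Finset.sum_add_distrib]
  refine Finset.sum_congr rfl fun n _ ↦ Finset.sum_congr rfl fun m _ ↦ ?_
  rw [sub_mul, Real.cos_sub]
  ring

/-- `cosList (sqTerms hs) θ ≥ 0`. [folklore] -/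
theorem cosList_sqTerms_nonneg (hs : List ℚ) (θ : ℝ) : 0 ≤ cosList (sqTerms hs) θ := by
  rw [cosList_sqTerms]; positivity

/-- Negate all coefficients. [folklore] -/
def negTerms (L : List (ℤ × ℚ)) : List (ℤ × ℚ) := L.map fun p ↦ (p.1, -p.2)

/-- `cosList (negTerms L) = −cosList L`. [folklore] -/
theorem cosList_negTerms (L : List (ℤ × ℚ)) (θ : ℝ) : cosList (negTerms L) θ = -cosList L θ := by
  unfold cosList negTerms
  induction L with
  | nil => simp
  | cons p ps ih => simp only [List.map_cons, List.sum_cons] at *; rw [ih]; push_cast; ring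

/-- `cosList (L₁ ++ L₂) = cosList L₁ + cosList L₂`. [folklore] -/
theorem cosList_append (L₁ L₂ : List (ℤ × ℚ)) (θ : ℝ) : cosList (L₁ ++ L₂) θ = cosList L₁ θ + cosList L₂ θ := by
  unfold cosList; rw [List.map_append, List.sum_append]

/-- **The SOS lower bound**: `−Σ_{l ≤ Lmax} |collect (L ++ negTerms (sqTerms hs)) l|`. [folklore] -/
def sosBound (L : List (ℤ × ℚ)) (hs : List ℚ) (Lmax : ℕ) : ℚ := -sumAbsCollect (L ++ negTerms (sqTerms hs)) Lmax

/-- Frequencies-bounded check for a list. [folklore] -/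
def freqsBelow (L : List (ℤ × ℚ)) (Lmax : ℕ) : Bool := L.all fun p ↦ decide (p.1.natAbs ≤ Lmax)

/-- Unpacking `freqsBelow`. [folklore] -/
theorem freqsBelow_spec {L : List (ℤ × ℚ)} {Lmax : ℕ} (h : freqsBelow L Lmax = true) : ∀ p ∈ L, p.1.natAbs ≤ Lmax := by
  unfold freqsBelow at h; simpa [List.all_eq_true] using h

/-- **Fejér–Riesz lower bound.** If all frequencies of `L ++ negTerms (sqTerms hs)` are `≤ Lmax`, then
`cosList L θ ≥ sosBound L hs Lmax` for every real `θ` (`cosList L = |h|² + remainder ≥ 0 − Σ|ρ_l|`). [folklore] -/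
theorem cosList_ge_sosBound {L : List (ℤ × ℚ)} {hs : List ℚ} {Lmax : ℕ}
    (h : freqsBelow (L ++ negTerms (sqTerms hs)) Lmax = true) (θ : ℝ) :
    ((sosBound L hs Lmax : ℚ) : ℝ) ≤ cosList L θ := by
  have h1 := cosList_ge_neg_sumAbs (freqsBelow_spec h) θ
  rw [cosList_append, cosList_negTerms] at h1
  have h2 := cosList_sqTerms_nonneg hs θ
  unfold sosBound
  push_cast
  linarith

/-! ## Separable phantoms and the level certificate -/

/-- The ripple list of a separable phantom: `θ₂`-harmonics `(j, 0, α)` then `θ₃`-harmonics `(0, k, β)`. [folklore] -/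
def rsOfSep (ph2 ph3 : List (ℤ × ℚ)) : List (ℤ × ℤ × ℚ) :=
  ph2.map (fun p ↦ (p.1, 0, p.2)) ++ ph3.map (fun p ↦ (0, p.1, p.2))

/-- `P(t) = f₂^{ph}(t log 2) + f₃^{ph}(t log 3)` for a separable phantom. [folklore] -/
theorem ripplesVal_rsOfSep (ph2 ph3 : List (ℤ × ℚ)) (t : ℝ) :
    ripplesVal (rsOfSep ph2 ph3) t = cosList ph2 (t * Real.log 2) + cosList ph3 (t * Real.log 3) := by
  unfold ripplesVal rsOfSep cosList
  rw [List.map_append, List.sum_append, List.map_map, List.map_map]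
  congr 1
  · congr 1
    refine List.map_congr_left fun p _ ↦ ?_
    simp only [Function.comp, rippleFreq]
    push_cast
    ring_nf
  · congr 1
    refine List.map_congr_left fun p _ ↦ ?_
    simp only [Function.comp, rippleFreq]
    push_cast
    ring_nf

/-- A LEVEL CERTIFICATE for `w₂₃ + P` beyond `T`, separable phantom: the phantom harmonics, the SOS witnesses, the
harmonic bounds, and the engine parameters of the digamma lower bound at `T`. [folklore] -/
structure SepLevelCert where
  /-- `θ₂ = t log 2` harmonics `(j, α_j)` of the phantom -/
  ph2 : List (ℤ × ℚ)
  /-- `θ₃ = t log 3` harmonics `(k, β_k)` of the phantom -/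
  ph3 : List (ℤ × ℚ)
  /-- SOS witness for `f₂` -/
  hs2 : List ℚ
  /-- SOS witness for `f₃` -/
  hs3 : List ℚ
  /-- harmonic bound for the `θ₂` part -/
  L2 : ℕ
  /-- harmonic bound for the `θ₃` part -/
  L3 : ℕ
  /-- engine precision for `Re ψ` -/
  prec : ℕ
  /-- dyadic exponent of `T` -/
  jT : ℕ
  /-- engine truncation for `Re ψ` -/
  mwT : ℕ

namespace SepLevelCert

variable (s : SepLevelCert)

/-- The ripple list certified. [folklore] -/
def rs : List (ℤ × ℤ × ℚ) := rsOfSep s.ph2 s.ph3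

/-- `f₂` with the prime-2 amplitude replaced by its rational upper end: `(1, −c₀⁺) :: ph2`. [folklore] -/
def list2 : List (ℤ × ℚ) := (1, -cZeroFI.hiQ) :: s.ph2

/-- `f₃` with the prime-3 amplitude replaced by its rational upper end: `(1, −c₃⁺) :: ph3`. [folklore] -/
def list3 : List (ℤ × ℚ) := (1, -cThreeFI.hiQ) :: s.ph3

/-- The certified lower bound of `f₂` (SOS bound minus the width of the amplitude enclosure). [folklore] -/
def m2 : ℚ := sosBound s.list2 s.hs2 s.L2 - (cZeroFI.hiQ - cZeroFI.loQ)

/-- The certified lower bound of `f₃`. [folklore] -/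
def m3 : ℚ := sosBound s.list3 s.hs3 s.L3 - (cThreeFI.hiQ - cThreeFI.loQ)

/-- **The checker**: harmonics bounded, `T` dyadic with `jT ≥ 1`, and `wL ≤ wLoZ(T) + m₂ + m₃`. [folklore] -/
def check (wL T : ℚ) : Bool :=
  freqsBelow (s.list2 ++ negTerms (sqTerms s.hs2)) s.L2 && freqsBelow (s.list3 ++ negTerms (sqTerms s.hs3)) s.L3 &&
    decide (1 ≤ s.jT) && decide (0 ≤ T) && decide (T * 2 ^ s.jT = ((dyNum T s.jT : ℕ) : ℚ)) &&
    decide (wL ≤ wLoZ s.prec (dyNum T s.jT) s.jT s.mwT + s.m2 + s.m3)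

variable {s}

/-- `f₂(θ) ≥ m₂`: the true `θ₂`-part is at least the SOS bound of its rationalised version minus the enclosure width. [folklore] -/
theorem f2_ge (h2 : freqsBelow (s.list2 ++ negTerms (sqTerms s.hs2)) s.L2 = true) (θ : ℝ) :
    ((s.m2 : ℚ) : ℝ) ≤ -(Real.sqrt 2 * Real.log 2) * Real.cos θ + cosList s.ph2 θ := by
  have hsos := cosList_ge_sosBound h2 θ
  have hlo : ((cZeroFI.loQ : ℚ) : ℝ) ≤ Real.sqrt 2 * Real.log 2 := FI.loQ_le mem_cZeroFI
  have hhi : Real.sqrt 2 * Real.log 2 ≤ ((cZeroFI.hiQ : ℚ) : ℝ) := FI.le_hiQ mem_cZeroFI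
  have e : cosList s.list2 θ = -((cZeroFI.hiQ : ℚ) : ℝ) * Real.cos θ + cosList s.ph2 θ := by
    unfold list2 cosList; simp
  rw [e] at hsos
  have hc : (((cZeroFI.hiQ : ℚ) : ℝ) - Real.sqrt 2 * Real.log 2) * Real.cos θ ≥
      -(((cZeroFI.hiQ : ℚ) : ℝ) - (cZeroFI.loQ : ℚ)) := by
    have h0 : 0 ≤ ((cZeroFI.hiQ : ℚ) : ℝ) - Real.sqrt 2 * Real.log 2 := by linarith
    have := mul_le_mul_of_nonneg_left (Real.neg_one_le_cos θ) h0
    nlinarith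
  unfold m2; push_cast; nlinarith

/-- `f₃(θ) ≥ m₃`. [folklore] -/
theorem f3_ge (h3 : freqsBelow (s.list3 ++ negTerms (sqTerms s.hs3)) s.L3 = true) (θ : ℝ) :
    ((s.m3 : ℚ) : ℝ) ≤ -(2 * Real.log 3 / Real.sqrt 3) * Real.cos θ + cosList s.ph3 θ := by
  have hsos := cosList_ge_sosBound h3 θ
  have hlo : ((cThreeFI.loQ : ℚ) : ℝ) ≤ 2 * Real.log 3 / Real.sqrt 3 := FI.loQ_le mem_cThreeFI
  have hhi : 2 * Real.log 3 / Real.sqrt 3 ≤ ((cThreeFI.hiQ : ℚ) : ℝ) := FI.le_hiQ mem_cThreeFI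
  have e : cosList s.list3 θ = -((cThreeFI.hiQ : ℚ) : ℝ) * Real.cos θ + cosList s.ph3 θ := by
    unfold list3 cosList; simp
  rw [e] at hsos
  have hc : (((cThreeFI.hiQ : ℚ) : ℝ) - 2 * Real.log 3 / Real.sqrt 3) * Real.cos θ ≥
      -(((cThreeFI.hiQ : ℚ) : ℝ) - (cThreeFI.loQ : ℚ)) := by
    have h0 : 0 ≤ ((cThreeFI.hiQ : ℚ) : ℝ) - 2 * Real.log 3 / Real.sqrt 3 := by linarith
    have := mul_le_mul_of_nonneg_left (Real.neg_one_le_cos θ) h0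
    nlinarith
  unfold m3; push_cast; nlinarith

/-- **The tail level of `w₂₃ + P` from the certificate**: if `s.check wL T = true` then
`wL ≤ w₂₃(t) + P(t)` for every `|t| ≥ T`, `P = ripplesVal (rsOfSep ph2 ph3)`. [folklore] -/
theorem level_of_check {wL T : ℚ} (h : s.check wL T = true) {t : ℝ} (ht : (T : ℝ) ≤ |t|) :
    (wL : ℝ) ≤ weilTwoPrimeWeight t + ripplesVal s.rs t := by
  unfold check at h
  simp only [Bool.and_eq_true, decide_eq_true_eq] at h
  obtain ⟨⟨⟨⟨⟨h2, h3⟩, hj⟩, hT0⟩, hT⟩, hwL⟩ := h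
  -- digamma part
  have hTe : ((dyNum T s.jT : ℕ) : ℝ) / 2 ^ s.jT = (T : ℝ) := by
    have : (T : ℝ) * 2 ^ s.jT = ((dyNum T s.jT : ℕ) : ℝ) := by exact_mod_cast hT
    rw [← this, mul_div_assoc, div_self (by positivity), mul_one]
  have hlev := wLoZ_le s.prec (dyNum T s.jT) hj s.mwT
  rw [hTe] at hlev
  have hT0' : (0 : ℝ) ≤ T := by exact_mod_cast hT0
  have hmono := reDigammaQuarter_mono (t := |t|) (u := (T : ℝ)) (by rwa [abs_abs, abs_of_nonneg hT0'])
  rw [reDigammaQuarter_abs] at hmono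
  -- the two ripple parts
  have hf2 := f2_ge h2 (t * Real.log 2)
  have hf3 := f3_ge h3 (t * Real.log 3)
  have hwL' : ((wL : ℚ) : ℝ) ≤ ((wLoZ s.prec (dyNum T s.jT) s.jT s.mwT : ℚ) : ℝ) + s.m2 + s.m3 := by
    exact_mod_cast hwL
  unfold rs
  rw [ripplesVal_rsOfSep, weilTwoPrimeWeight]
  linarith

end SepLevelCert

end Summit.RiemannHypothesis.RiemannHypothesis.Theorems.EvenWinsBeyondArch

end
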